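import Mathlib
import Literature.Combinatorics.Optimization.ParityImpliedPredicateSosGap

/-!
# Kothari–Meka–Raghavendra 2017, Cor. 1.5 for an arbitrary Max-CSP: a linear-round Sherali–Adams
# gap plus Theorem 1.10 gives an LP-size lower bound `2^{c n^{1/H}}` for beating the random threshold

The printed proof of KMR Cor. 1.5 (p. 21: Thm 1.2 — itself from Thm 1.10, the tree's
`KothariMekaRaghavendra2017_thm12_of_thm110` — applied on `m^H` variables to a degree-`⌊c_ε m⌋`
Sherali–Adams gap, restriction `n ↦ ⌊n^{1/H}⌋^H`, `(2 − ε)s ≤ c − 1/m`) is predicate-independent; the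
tree runs it for MAX-3SAT (`KothariMekaRaghavendra2017_cor15_threeSat_of_thm110`) and MAX-3XOR
(`KothariMekaRaghavendra2017_cor15_threeXor_of_thm110`).  Here it is run ONCE for an arbitrary
predicate set `𝒫` and threshold `0 < s₀ < 1`
(`KothariMekaRaghavendra2017_lpGap_of_SAgap_of_thm110`): a Sherali–Adams gap of the shape of
KMR Thm 7.5 — for every `ε > 0`, `c_ε > 0`, `n₀` with degree-`⌊c_ε n⌋` SA failing to
`(1 − ε, s₀ + ε)`-approximate Max-`𝒫_n`, `n ≥ n₀` — yields, ASSUMING Thm 1.10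
(`KothariMekaRaghavendra2017_thm110`, the paper's engine, a named fact of the tree), constants
`H ≥ 1` and, for every `ε > 0`, `c₁ > 0`, `N₀` such that no LP relaxation of Max-`𝒫_N` of size
`< 2^{c₁ N^{1/H}}` has integrality gap `< 1/s₀ − ε` (`N ≥ N₀`).

Fed with the PROVED Sherali–Adams gaps of this directory it gives KMR Cor. 1.5 / Thm 1.4-type LP
lower bounds, conditional on Thm 1.10 alone, for: Max-`k`-XOR, every `k ≥ 3` (ratio `2 − ε`;
`KothariMekaRaghavendra2017_cor15_kXor_of_thm110`, from `Schoenebeck2008_maxKXorSA`), and every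
Max-`k`-CSP(`P`) with `P` implied by parity and not identically true (ratio `2^k/|P⁻¹(1)| − ε`;
`KothariMekaRaghavendra2017_cor15_parityImplied_of_thm110`, from `Schoenebeck2008_parityImplied_SA`),
in particular Max-`k`-SAT (`orK`, `orK_of_xorK`, `card_filter_orK : |or_k⁻¹(1)| = 2^k − 1`,
`maxKSatPreds_eq_literalClosure_orK`; ratio `2^k/(2^k − 1) − ε`,
`KothariMekaRaghavendra2017_cor15_kSat_of_thm110`; in the tree's `maxKSatPreds` currency:
`Schoenebeck2008_maxKSatSA`, `KothariMekaRaghavendra2017_cor15_maxKSat_of_thm110`).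

The only definition is the predicate `orK` (`orK 3 = orThree`).

No new facts (D-0026).

## References

* P. Kothari, R. Meka, P. Raghavendra, *Approximating rectangles by juntas and weakly-exponential
  lower bounds for LP relaxations of CSPs*, STOC 2017 / SICOMP 2022, Thm 1.2, Thm 1.4, Cor 1.5 and its
  proof (p. 21), Thm 7.5 [KothariMekaRaghavendra2017]; held text `paper:arxiv-1610.02704`.
* G. Schoenebeck, FOCS 2008 [Schoenebeck2008]; M. Tulsiani, STOC 2009, §4.3 [Tulsiani2009].
-/

noncomputable section

open Finset Filter

namespace Literature.Combinatorics.Optimization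

/-- **KMR Cor. 1.5 for an arbitrary Max-CSP, from a linear-round Sherali–Adams gap and Thm 1.10.**
Let `0 < s₀ < 1` and suppose that for every `ε > 0` there are `c_ε > 0`, `n₀` such that for all
`n ≥ n₀` the degree-`⌊c_ε n⌋` Sherali–Adams relaxation fails to `(1 − ε, s₀ + ε)`-approximate
Max-`𝒫_n`.  Then (assuming Thm 1.10) there is `H ≥ 1` such that for every `ε > 0` there are
`c₁ > 0`, `N₀` with: for all `N ≥ N₀`, no LP relaxation of Max-`𝒫_N` of size `R < 2^{c₁ N^{1/H}}`
has integrality gap `< 1/s₀ − ε`.  Proof as printed for Cor. 1.5 (p. 21): WLOG `ε ≤ 1 − s₀`;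
`δ = ε s₀²/8`, `(c, s) = (1 − δ, s₀ + δ)`, `f(m) = ⌊c_δ m⌋`; Thm 1.2 on `m^H` variables,
`m = ⌊N^{1/H}⌋`, restriction of the relaxation; `(1/s₀ − ε) s ≤ c − 1/m`; `2^{c₁ N^{1/H}} ≤ m^{h f(m)}`
for `c₁ = h c_δ/4`. [cite: KothariMekaRaghavendra2017, Cor. 1.5 and its proof (§7, p. 21), Thm 1.2, Thm 1.4] -/
theorem KothariMekaRaghavendra2017_lpGap_of_SAgap_of_thm110
    (h110 : KothariMekaRaghavendra2017_thm110) {k : ℕ} (P : Set ((Fin k → Bool) → Bool))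
    {s₀ : ℝ} (hs₀ : 0 < s₀) (hs₁ : s₀ < 1)
    (hSAgap : ∀ ε : ℝ, 0 < ε → ∃ cε : ℝ, 0 < cε ∧ ∃ n₀ : ℕ, ∀ n : ℕ, n₀ ≤ n →
      ¬ SAAchieves (n := n) P ⌊cε * n⌋₊ (1 - ε) (s₀ + ε)) :
    ∃ H : ℝ, 1 ≤ H ∧ ∀ ε : ℝ, 0 < ε → ∃ c₁ : ℝ, 0 < c₁ ∧ ∃ N₀ : ℕ, ∀ N : ℕ, N₀ ≤ N →
      ∀ R : ℕ, (R : ℝ) < (2 : ℝ) ^ (c₁ * (N : ℝ) ^ (1 / H)) →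
        ∀ L : LPRelaxation k N P R, ¬ L.GapLT (1 / s₀ - ε) := by
  obtain ⟨h, H, n₀, hh, hhH, T12⟩ := KothariMekaRaghavendra2017_thm12_of_thm110 h110
  have hH0 : H ≠ 0 := by
    rintro rfl
    simp at hhH
    linarith
  have hH1 : (1 : ℝ) ≤ H := by exact_mod_cast Nat.one_le_iff_ne_zero.2 hH0
  have hHpos : (0 : ℝ) < H := by linarith
  refine ⟨H, hH1, ?_⟩
  -- WLOG `ε ≤ 1 − s₀`
  suffices main : ∀ ε : ℝ, 0 < ε → ε ≤ 1 - s₀ → ∃ c₁ : ℝ, 0 < c₁ ∧ ∃ N₀ : ℕ, ∀ N : ℕ, N₀ ≤ N →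
      ∀ R : ℕ, (R : ℝ) < (2 : ℝ) ^ (c₁ * (N : ℝ) ^ (1 / (H : ℝ))) →
        ∀ L : LPRelaxation k N P R, ¬ L.GapLT (1 / s₀ - ε) by
    intro ε hε
    obtain ⟨c₁, hc₁, N₀, hN₀⟩ := main (min ε (1 - s₀)) (lt_min hε (by linarith)) (min_le_right _ _)
    exact ⟨c₁, hc₁, N₀, fun N hN R hR L hL =>
      hN₀ N hN R hR L (hL.mono (by linarith [min_le_left ε (1 - s₀)]))⟩
  intro ε hε hε1
  -- parameters `δ = ε s₀²/8`, `(c,s) = (1 − δ, s₀ + δ)`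
  set δ : ℝ := ε * s₀ ^ 2 / 8 with hδdef
  have hδ : 0 < δ := by rw [hδdef]; positivity
  have hs₀2 : s₀ ^ 2 ≤ s₀ := by nlinarith
  have hδle : δ ≤ ε * s₀ / 8 := by
    rw [hδdef]
    have := mul_le_mul_of_nonneg_left hs₀2 hε.le
    linarith
  have hδle' : δ ≤ (1 - s₀) / 8 := by
    have : ε * s₀ ≤ 1 - s₀ := by nlinarith
    linarith
  -- the Sherali–Adams gap at `δ`
  obtain ⟨cε, hcε, n₁, HSA⟩ := hSAgap δ hδ
  set s : ℝ := s₀ + δ with hsdef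
  set c : ℝ := 1 - δ with hcdef
  have hs0 : 0 ≤ s := by rw [hsdef]; linarith
  have hc1 : c ≤ 1 := by rw [hcdef]; linarith
  set f : ℕ → ℕ := fun m => ⌊cε * m⌋₊ with hfdef
  set c₁ : ℝ := h * cε / 4 with hc₁def
  have hc₁ : 0 < c₁ := by rw [hc₁def]; positivity
  -- thresholds
  set nthr : ℕ := n₀ + n₁ + 10 + ⌈(16 * k + 2 : ℝ) / cε⌉₊ + ⌈2 / (ε * s₀)⌉₊ + ⌈4 / (1 - s₀)⌉₊
    with hnthr
  refine ⟨c₁, hc₁, (nthr + 1) ^ H, fun N hN R hR L hL => ?_⟩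
  -- `y = N^{1/H}`, `m = ⌊y⌋`
  set y : ℝ := (N : ℝ) ^ (1 / (H : ℝ)) with hydef
  have hy0 : 0 ≤ y := Real.rpow_nonneg (Nat.cast_nonneg N) _
  have hyH : y ^ H = N := by
    rw [hydef, one_div]; exact Real.rpow_inv_natCast_pow (Nat.cast_nonneg N) hH0
  have hythr : (nthr : ℝ) + 1 ≤ y := by
    have h1 : (((nthr + 1) ^ H : ℕ) : ℝ) ≤ N := by exact_mod_cast hN
    have h2 : ((((nthr + 1) ^ H : ℕ) : ℝ)) ^ (1 / (H : ℝ)) ≤ y :=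
      Real.rpow_le_rpow (Nat.cast_nonneg _) h1 (by positivity)
    have h3 : ((((nthr + 1) ^ H : ℕ) : ℝ)) ^ (1 / (H : ℝ)) = nthr + 1 := by
      push_cast
      rw [one_div]
      exact Real.pow_rpow_inv_natCast (by positivity) hH0
    linarith
  set m : ℕ := ⌊y⌋₊ with hmdef
  have hmy : (m : ℝ) ≤ y := Nat.floor_le hy0
  have hmy' : y - 1 ≤ (m : ℝ) := (Nat.sub_one_lt_floor y).le
  have hmthr : nthr ≤ m := by
    have : (nthr : ℝ) ≤ m := by linarith
    exact_mod_cast this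
  have hnthr10 : (10 : ℝ) ≤ nthr := by exact_mod_cast (by omega : 10 ≤ nthr)
  have hmy2 : y / 2 ≤ (m : ℝ) := by linarith
  have hmH : m ^ H ≤ N := by
    have h1 : ((m : ℝ)) ^ H ≤ y ^ H := pow_le_pow_left₀ (Nat.cast_nonneg m) hmy H
    rw [hyH] at h1
    exact_mod_cast h1
  -- consequences of `m ≥ nthr`
  have hmn₀ : n₀ ≤ m := by omega
  have hmn₁ : n₁ ≤ m := by omega
  have hm10 : 10 ≤ m := by omega
  have hmR : (10 : ℝ) ≤ m := by exact_mod_cast hm10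
  have hm0 : (0 : ℝ) < m := by linarith
  have hmk : (16 * k + 2 : ℝ) / cε ≤ (m : ℝ) := by
    have h1 : ⌈(16 * k + 2 : ℝ) / cε⌉₊ ≤ m := by omega
    exact (Nat.le_ceil _).trans (by exact_mod_cast h1)
  have hmε : 2 / (ε * s₀) ≤ (m : ℝ) := by
    have h1 : ⌈2 / (ε * s₀)⌉₊ ≤ m := by omega
    exact (Nat.le_ceil _).trans (by exact_mod_cast h1)
  have hms : 4 / (1 - s₀) ≤ (m : ℝ) := by
    have h1 : ⌈4 / (1 - s₀)⌉₊ ≤ m := by omega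
    exact (Nat.le_ceil _).trans (by exact_mod_cast h1)
  have hcεm : 16 * k + 2 ≤ cε * m := by
    rw [div_le_iff₀ hcε] at hmk; linarith
  have h1mε : 1 / (m : ℝ) ≤ ε * s₀ / 2 := by
    have hεs : 0 < ε * s₀ := by positivity
    have h1 : 1 / (m : ℝ) ≤ 1 / (2 / (ε * s₀)) := one_div_le_one_div_of_le (by positivity) hmε
    rw [one_div_div] at h1
    linarith
  have h1ms : 1 / (m : ℝ) ≤ (1 - s₀) / 4 := by
    have h1 : 1 / (m : ℝ) ≤ 1 / (4 / (1 - s₀)) := one_div_le_one_div_of_le (by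
      have : 0 < 1 - s₀ := by linarith
      positivity) hms
    rw [one_div_div] at h1
    linarith
  -- `f(m) = ⌊cε m⌋`: `16k ≤ f(m)`, `f(m) ≥ (cε/2) m`
  have hfm_ge : cε * m - 1 ≤ ((f m : ℕ) : ℝ) := (Nat.sub_one_lt_floor _).le
  have h16k : 16 * k ≤ f m := by
    apply Nat.le_floor
    push_cast
    linarith
  have hfm4 : cε / 2 * m ≤ ((f m : ℕ) : ℝ) := by
    have hk0 : (0 : ℝ) ≤ k := Nat.cast_nonneg k
    linarith
  -- Sherali–Adams fails `(c,s)` at degree `f(m)` on `m` variables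
  have hSA : ¬ SAAchieves (n := m) P (f m) c s := HSA m hmn₁
  -- the restricted relaxation achieves `(c − 1/m, s)` on `m^H` variables
  have hgap : 1 / (m : ℝ) < c - s := by
    rw [hcdef, hsdef]; linarith
  have hρ : (1 / s₀ - ε) * s ≤ c - 1 / m := by
    have h1 : (1 / s₀ - ε) * s = 1 + δ / s₀ - ε * s₀ - ε * δ := by
      rw [hsdef]; field_simp; ring
    have h2 : δ / s₀ = ε * s₀ / 8 := by
      rw [hδdef]; field_simp
    rw [h1, h2, hcdef]
    have h3 : 0 ≤ ε * δ := by positivity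
    linarith
  have hc0 : 0 ≤ c - 1 / m := by rw [hcdef]; linarith
  have hAch : (L.restrict (Fin.castLEEmb hmH)).Achieves (c - 1 / m) s :=
    (hL.achieves hs0 hρ hc0).restrict _
  -- the size bound: `R < 2^{c₁ N^{1/H}} ≤ m^{h f(m)}`
  have hkey : (2 : ℝ) ^ (c₁ * y) ≤ (m : ℝ) ^ (h * (f m : ℕ)) := by
    rw [Real.rpow_def_of_pos two_pos, Real.rpow_def_of_pos hm0, Real.exp_le_exp]
    have hlog2 : 0 < Real.log 2 := Real.log_pos one_lt_two
    have hlog2m : Real.log 2 ≤ Real.log m :=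
      Real.log_le_log two_pos (le_trans (by norm_num) hmR)
    have hfy : cε / 2 * (y / 2) ≤ ((f m : ℕ) : ℝ) :=
      le_trans (mul_le_mul_of_nonneg_left hmy2 (by positivity)) hfm4
    calc Real.log 2 * (c₁ * y) = Real.log 2 * h * (cε / 2 * (y / 2)) := by rw [hc₁def]; ring
      _ ≤ Real.log 2 * h * ((f m : ℕ) : ℝ) :=
          mul_le_mul_of_nonneg_left hfy (by positivity)
      _ ≤ Real.log m * h * ((f m : ℕ) : ℝ) := by
          apply mul_le_mul_of_nonneg_right (mul_le_mul_of_nonneg_right hlog2m hh.le)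
          positivity
      _ = Real.log m * (h * ((f m : ℕ) : ℝ)) := by ring
  have hRle : (R : ℝ) ≤ (m : ℝ) ^ (h * (f m : ℕ)) := (hR.trans_le hkey).le
  exact T12 k P c s hc1 f m hmn₀ hgap h16k hSA R hRle _ hAch

/-! ### Instances: Max-`k`-XOR and parity-implied predicates (conditional on Thm 1.10 only) -/

/-- **KMR Cor. 1.5 / Thm 1.4 for Max-`k`-XOR, every `k ≥ 3`, from Thm 1.10 ALONE:** for the `H` of
Thm 1.2, for every `ε > 0` there are `c₂ > 0`, `n₀` such that for `n ≥ n₀` no LP relaxation of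
Max-`k`-XOR of size `< 2^{c₂ n^{1/H}}` has integrality gap `< 2 − ε` (the Sherali–Adams input is the
PROVED `Schoenebeck2008_maxKXorSA`). [cite: KothariMekaRaghavendra2017, Thm 1.4 and Cor. 1.5 (p. 4), proof p. 21] -/
theorem KothariMekaRaghavendra2017_cor15_kXor_of_thm110 (h110 : KothariMekaRaghavendra2017_thm110)
    {k : ℕ} (hk : 3 ≤ k) :
    ∃ H : ℝ, 1 ≤ H ∧ ∀ ε : ℝ, 0 < ε → ∃ c₂ : ℝ, 0 < c₂ ∧ ∃ n₀ : ℕ, ∀ n : ℕ, n₀ ≤ n →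
      ∀ R : ℕ, (R : ℝ) < (2 : ℝ) ^ (c₂ * (n : ℝ) ^ (1 / H)) →
        ∀ L : LPRelaxation k n (literalClosure (xorK k)) R, ¬ L.GapLT (2 - ε) := by
  obtain ⟨H, hH, hmain⟩ := KothariMekaRaghavendra2017_lpGap_of_SAgap_of_thm110 h110
    (literalClosure (xorK k)) (s₀ := 1 / 2) (by norm_num) (by norm_num) (Schoenebeck2008_maxKXorSA hk)
  refine ⟨H, hH, fun ε hε => ?_⟩
  obtain ⟨c₁, hc₁, N₀, hN⟩ := hmain ε hε
  refine ⟨c₁, hc₁, N₀, fun N hN' R hR L => ?_⟩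
  have h := hN N hN' R hR L
  rwa [show (1 : ℝ) / (1 / 2) - ε = 2 - ε by norm_num] at h

/-- A predicate implied by parity accepts the odd-weight point `e_0`, so `|P⁻¹(1)| ≥ 1` (`k ≥ 1`).
[cite: Tulsiani2009, §4.3 (Def. 4.9)] -/
theorem card_filter_pred_pos_of_parityImplied {k : ℕ} (hk : 1 ≤ k) {P : (Fin k → Bool) → Bool}
    (hP : ∀ y, xorK k y = true → P y = true) :
    0 < ((univ : Finset (Fin k → Bool)).filter fun y => P y = true).card := by
  have hy : xorK k (fun j => decide (j = (⟨0, hk⟩ : Fin k))) = true := by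
    unfold xorK
    rw [decide_eq_true_eq]
    have : ((univ : Finset (Fin k)).filter fun j : Fin k =>
        decide (j = (⟨0, hk⟩ : Fin k)) = true) = {⟨0, hk⟩} := by
      ext j; simp
    rw [this, Finset.card_singleton]
    exact odd_one
  exact Finset.card_pos.2 ⟨_, Finset.mem_filter.2 ⟨Finset.mem_univ _, hP _ hy⟩⟩

/-- A predicate that is not identically true has `|P⁻¹(1)| < 2^k`. [cite: Tulsiani2009, §4.3 (p. 18: "the largest integrality gap one can have is `q^k/|P⁻¹(1)|`")] -/
theorem card_filter_pred_lt_of_exists_false {k : ℕ} {P : (Fin k → Bool) → Bool}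
    (hPne : ∃ y, P y = false) :
    ((univ : Finset (Fin k → Bool)).filter fun y => P y = true).card < 2 ^ k := by
  obtain ⟨y₀, hy₀⟩ := hPne
  have hss : ((univ : Finset (Fin k → Bool)).filter fun y => P y = true) ⊂ univ :=
    Finset.filter_ssubset.2 ⟨y₀, Finset.mem_univ _, by simp [hy₀]⟩
  calc _ < (univ : Finset (Fin k → Bool)).card := Finset.card_lt_card hss
    _ = 2 ^ k := by rw [Finset.card_univ, Fintype.card_fun, Fintype.card_bool, Fintype.card_fin]

/-- **KMR Cor. 1.5-type LP lower bound for every Max-`k`-CSP(`P`) with `P` implied by parity and not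
identically true, every `k ≥ 3`, from Thm 1.10 ALONE:** for the `H` of Thm 1.2 and every `ε > 0`
there are `c₂ > 0`, `n₀` such that for `n ≥ n₀` no LP relaxation of Max-`k`-CSP(`P`) of size
`< 2^{c₂ n^{1/H}}` has integrality gap `< 2^k/|P⁻¹(1)| − ε` (Sherali–Adams input: the PROVED
`Schoenebeck2008_parityImplied_SA`).  Max-`k`-SAT (`2^k/(2^k − 1) − ε`) and Max-`k`-XOR (`2 − ε`)
are the cases `P = or_k`, `P = xor_k`. [cite: KothariMekaRaghavendra2017, Thm 1.4 and Cor. 1.5 (p. 4), proof p. 21]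
[cite: Tulsiani2009, Thm 4.11 (proof, p. 19–20)] -/
theorem KothariMekaRaghavendra2017_cor15_parityImplied_of_thm110
    (h110 : KothariMekaRaghavendra2017_thm110) {k : ℕ} (hk : 3 ≤ k) {P : (Fin k → Bool) → Bool}
    (hP : ∀ y, xorK k y = true → P y = true) (hPne : ∃ y, P y = false) :
    ∃ H : ℝ, 1 ≤ H ∧ ∀ ε : ℝ, 0 < ε → ∃ c₂ : ℝ, 0 < c₂ ∧ ∃ n₀ : ℕ, ∀ n : ℕ, n₀ ≤ n →
      ∀ R : ℕ, (R : ℝ) < (2 : ℝ) ^ (c₂ * (n : ℝ) ^ (1 / H)) →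
        ∀ L : LPRelaxation k n (literalClosure P) R,
          ¬ L.GapLT ((2 : ℝ) ^ k / ((univ : Finset (Fin k → Bool)).filter fun y => P y = true).card - ε) := by
  set NP := ((univ : Finset (Fin k → Bool)).filter fun y => P y = true).card with hNP
  have hNP0 : (0 : ℝ) < NP := by exact_mod_cast card_filter_pred_pos_of_parityImplied (by omega) hP
  have hNPlt : (NP : ℝ) < 2 ^ k := by exact_mod_cast card_filter_pred_lt_of_exists_false hPne
  have h2k : (0 : ℝ) < 2 ^ k := by positivity
  have hs₀ : (0 : ℝ) < NP / 2 ^ k := by positivity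
  have hs₁ : (NP : ℝ) / 2 ^ k < 1 := by rw [div_lt_one h2k]; exact hNPlt
  obtain ⟨H, hH, hmain⟩ := KothariMekaRaghavendra2017_lpGap_of_SAgap_of_thm110 h110
    (literalClosure P) hs₀ hs₁ (Schoenebeck2008_parityImplied_SA hk hP)
  refine ⟨H, hH, fun ε hε => ?_⟩
  obtain ⟨c₁, hc₁, N₀, hN⟩ := hmain ε hε
  refine ⟨c₁, hc₁, N₀, fun N hN' R hR L => ?_⟩
  have h := hN N hN' R hR L
  rwa [one_div_div] at h

/-! ### Max-`k`-SAT as the parity-implied predicate `or_k` -/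

/-- The `k`-ary disjunction `y_0 ∨ ⋯ ∨ y_{k−1}`; Max-`k`-SAT = CSP(`or_k`) with literals.
[cite: KothariMekaRaghavendra2017, §1 (p. 3: MAX-3SAT = CSP(`or₃`))] -/
def orK (k : ℕ) : (Fin k → Bool) → Bool := fun y => decide (∃ j, y j = true)

/-- `orK 3` is the tree's `orThree`. [cite: KothariMekaRaghavendra2017, §1 (p. 3)] -/
theorem orK_three : orK 3 = orThree := by
  funext y
  have h : ∀ y : Fin 3 → Bool, orK 3 y = orThree y := by decide
  exact h y

/-- **Parity implies disjunction:** an odd number of true coordinates is at least one.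
[cite: Schoenebeck2008, §5 (from `k`-XOR to `k`-SAT)] -/
theorem orK_of_xorK {k : ℕ} (y : Fin k → Bool) (h : xorK k y = true) : orK k y = true := by
  unfold xorK at h
  unfold orK
  rw [decide_eq_true_eq] at h ⊢
  by_contra hne
  push Not at hne
  have h0 : ((univ : Finset (Fin k)).filter fun j => y j = true) = ∅ :=
    Finset.filter_eq_empty_iff.2 fun j _ => by simpa using hne j
  rw [h0, Finset.card_empty] at h
  exact (Nat.not_odd_iff_even.2 (by decide : Even 0)) h

/-- `or_k` rejects exactly the all-false point: `|or_k⁻¹(1)| = 2^k − 1`.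
[cite: KothariMekaRaghavendra2017, Cor. 1.5 (p. 4: ratio `8/7` for MAX-3SAT)] -/
theorem card_filter_orK (k : ℕ) :
    ((univ : Finset (Fin k → Bool)).filter fun y => orK k y = true).card = 2 ^ k - 1 := by
  have hfilter : ((univ : Finset (Fin k → Bool)).filter fun y => orK k y = true) =
      (univ : Finset (Fin k → Bool)).erase (fun _ => false) := by
    rw [← Finset.filter_ne']
    refine Finset.filter_congr fun y _ => ?_
    unfold orK
    rw [decide_eq_true_eq]
    constructor
    · rintro ⟨j, hj⟩ h
      rw [h] at hj
      exact Bool.false_ne_true hj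
    · intro hne
      by_contra hall
      push Not at hall
      exact hne (funext fun j => by simpa using hall j)
  rw [hfilter, Finset.card_erase_of_mem (Finset.mem_univ _), Finset.card_univ, Fintype.card_fun,
    Fintype.card_bool, Fintype.card_fin]

/-- The tree's `maxKSatPreds k` (all `2^k` disjunctions of literals, `MaxKSatSosGap.lean`) is
CSP(`or_k`) with literals. [cite: LeeRaghavendraSteurer2015, §1.2 (p. 6)] [cite: KothariMekaRaghavendra2017, §1.1 (p. 3)] -/
theorem maxKSatPreds_eq_literalClosure_orK (k : ℕ) : maxKSatPreds k = literalClosure (orK k) := by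
  have hx : ∀ a b : Bool, (xor a b = true) ↔ a ≠ b := by decide
  have hfg : (fun σ : Fin k → Bool => fun y : Fin k → Bool => decide (y ≠ σ)) =
      fun σ => fun y => orK k fun j => xor (y j) (σ j) := by
    funext σ y
    unfold orK
    rw [Bool.eq_iff_iff, decide_eq_true_iff, decide_eq_true_iff, Function.ne_iff]
    simp only [hx]
  unfold maxKSatPreds literalClosure
  rw [hfg]

/-- **KMR Cor. 1.5 / Thm 1.4 for Max-`k`-SAT, every `k ≥ 3`, from Thm 1.10 ALONE:** no LP relaxation
of Max-`k`-SAT (= CSP(`or_k`), cf. `maxKSatPreds_eq_literalClosure_orK`) of size `< 2^{c₂ n^{1/H}}`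
has integrality gap `< 2^k/(2^k − 1) − ε`. [cite: KothariMekaRaghavendra2017, Thm 1.4 and Cor. 1.5 (p. 4), proof p. 21] -/
theorem KothariMekaRaghavendra2017_cor15_kSat_of_thm110 (h110 : KothariMekaRaghavendra2017_thm110)
    {k : ℕ} (hk : 3 ≤ k) :
    ∃ H : ℝ, 1 ≤ H ∧ ∀ ε : ℝ, 0 < ε → ∃ c₂ : ℝ, 0 < c₂ ∧ ∃ n₀ : ℕ, ∀ n : ℕ, n₀ ≤ n →
      ∀ R : ℕ, (R : ℝ) < (2 : ℝ) ^ (c₂ * (n : ℝ) ^ (1 / H)) →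
        ∀ L : LPRelaxation k n (literalClosure (orK k)) R,
          ¬ L.GapLT ((2 : ℝ) ^ k / (2 ^ k - 1) - ε) := by
  have hPne : ∃ y : Fin k → Bool, orK k y = false := ⟨fun _ => false, by simp [orK]⟩
  obtain ⟨H, hH, hmain⟩ :=
    KothariMekaRaghavendra2017_cor15_parityImplied_of_thm110 h110 hk (P := orK k) orK_of_xorK hPne
  refine ⟨H, hH, fun ε hε => ?_⟩
  obtain ⟨c₂, hc₂, N₀, hN⟩ := hmain ε hε
  refine ⟨c₂, hc₂, N₀, fun N hN' R hR L => ?_⟩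
  have h := hN N hN' R hR L
  have hcast : (((univ : Finset (Fin k → Bool)).filter fun y => orK k y = true).card : ℝ) = 2 ^ k - 1 := by
    rw [card_filter_orK, Nat.cast_sub Nat.one_le_two_pow]; push_cast; ring
  rwa [hcast] at h

/-! ### The same in the tree's `maxKSatPreds` currency -/

/-- **Schoenebeck 2008 for Max-`k`-SAT in Sherali–Adams currency (shape of KMR Thm 7.5), every
`k ≥ 3` — PROVED:** degree-`⌊c_ε n⌋` Sherali–Adams does not `(1 − ε, 1 − 2^{−k} + ε)`-approximate
Max-`k`-SAT (`maxKSatPreds k`) on `n ≥ n₀` variables (`Schoenebeck2008_parityImplied_SA` at `P = or_k`,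
`|or_k⁻¹(1)|/2^k = 1 − 2^{−k}`). [cite: Schoenebeck2008, §5] [cite: KothariMekaRaghavendra2017, Thm 7.5 / Thm 1.4 (p. 4, 21)] -/
theorem Schoenebeck2008_maxKSatSA {k : ℕ} (hk : 3 ≤ k) :
    ∀ ε : ℝ, 0 < ε → ∃ cε : ℝ, 0 < cε ∧ ∃ n₀ : ℕ, ∀ n : ℕ, n₀ ≤ n →
      ¬ SAAchieves (n := n) (maxKSatPreds k) ⌊cε * n⌋₊ (1 - ε) (1 - 1 / 2 ^ k + ε) := by
  intro ε hε
  obtain ⟨cε, hcε, n₀, H⟩ := Schoenebeck2008_parityImplied_SA hk (P := orK k) orK_of_xorK ε hε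
  refine ⟨cε, hcε, n₀, fun n hn => ?_⟩
  have h := H n hn
  have hcast : (((univ : Finset (Fin k → Bool)).filter fun y => orK k y = true).card : ℝ) / 2 ^ k =
      1 - 1 / 2 ^ k := by
    have h2k : (0 : ℝ) < 2 ^ k := by positivity
    rw [card_filter_orK, Nat.cast_sub Nat.one_le_two_pow]
    push_cast
    field_simp
  rwa [hcast, ← maxKSatPreds_eq_literalClosure_orK] at h

/-- **KMR Cor. 1.5 / Thm 1.4 for Max-`k`-SAT (`maxKSatPreds k`), every `k ≥ 3`, from Thm 1.10
ALONE.** [cite: KothariMekaRaghavendra2017, Thm 1.4 and Cor. 1.5 (p. 4), proof p. 21] -/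
theorem KothariMekaRaghavendra2017_cor15_maxKSat_of_thm110 (h110 : KothariMekaRaghavendra2017_thm110)
    {k : ℕ} (hk : 3 ≤ k) :
    ∃ H : ℝ, 1 ≤ H ∧ ∀ ε : ℝ, 0 < ε → ∃ c₂ : ℝ, 0 < c₂ ∧ ∃ n₀ : ℕ, ∀ n : ℕ, n₀ ≤ n →
      ∀ R : ℕ, (R : ℝ) < (2 : ℝ) ^ (c₂ * (n : ℝ) ^ (1 / H)) →
        ∀ L : LPRelaxation k n (maxKSatPreds k) R,
          ¬ L.GapLT ((2 : ℝ) ^ k / (2 ^ k - 1) - ε) := by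
  rw [maxKSatPreds_eq_literalClosure_orK]
  exact KothariMekaRaghavendra2017_cor15_kSat_of_thm110 h110 hk

end Literature.Combinatorics.Optimization

end
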